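import Literature.AlgebraicGeometry.HodgeTheory.HodgeSectionRestrictionProofs
import Literature.AlgebraicGeometry.HodgeTheory.HodgeIndexSurface
import Literature.AlgebraicGeometry.HodgeTheory.HypersurfaceComplexPoints
import Literature.ModelTheory.ExponentialFields.SemialgebraicC1Triangulation
import Literature.NumberTheory.Transcendental.SemialgebraicMapsProofs
import Mathlib.Analysis.Convex.Contractible
import Mathlib.Topology.Homotopy.LocallyContractible
import HarnessLib

/-!
# Hodge classes restrict non-trivially to hypersurface sections: local contractibility of complex projective algebraic sets from semialgebraic triangulation (proved reduction)

Family `hodge`, layer `Literature/AlgebraicGeometry/HodgeTheory`. Second companion of the named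
fact `hodgeSectionRestriction_of_hodgeConjectureFor` (file `HodgeSectionRestriction`;
P. Brosnan, H. Fang, Z. Nie, G. Pearlstein, *Singularities of admissible normal functions*,
Invent. Math. 177 (2009), §6 Lemma 50 with Lemma 49). The first companion
(`HodgeSectionRestrictionProofs`) formalised the printed proof of Lemma 50 and reduced the fact
to two classical inputs absent from the tree: (P) the perfect pairing on middle Hodge classes
("Poincaré duality and the Hodge–Riemann bilinear relations") and (LC) the local contractibility
of the complex points `Z(ℂ)` of the Zariski-closed subsets `Z` of a smooth projective complex
variety (`hodgeSectionRestriction_of_hodgeConjectureFor_of_pairing_of_locallyContractible`).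

This file PROVES (LC) from the one theory-sized input that the tree already carries as a named
fact, the semialgebraic triangulation theorem in the form
`Literature.ModelTheory.ExponentialFields.OhmotoShiota2017_c1Triangulation` (Ohmoto–Shiota 2017,
Thm. 1.1, with Łojasiewicz's Thm. 2.2: every compact semialgebraic subset of `ℝᴺ` is
semialgebraically homeomorphic to the polyhedron of a FINITE simplicial complex). No new named
fact is introduced (D-0026) and the named fact itself is untouched (it is NOT discharged here: (P)
remains, see "What is NOT here").

## The chain (all links proved here)

* (T1) **Polyhedra are locally contractible** (`Polyhedron.locallyContractibleSpace_space`): the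
  polyhedron `|K| ⊆ E` of a finite geometric simplicial complex (Mathlib
  `Geometry.SimplicialComplex`, `K.faces.Finite`) in a real normed space is strongly locally
  contractible — every `x ∈ |K|` has the open neighbourhood `|K| ∩ U_x`,
  `U_x = ⋂ {(conv t)ᶜ : t ∈ K, x ∉ conv t}` (the open star of `x`), which is STAR-SHAPED about `x`
  (`Polyhedron.starConvex_space_inter_starNhd`: if `y ∈ conv s ∋ x` and a point of the segment
  `[x, y)` lay in a simplex `conv t ∌ x`, it would lie in the face `conv (s ∩ t)` of `s`, and by
  uniqueness of barycentric coordinates in `s` (`AffineIndependent.eq_of_sum_eq_sum_subtype`)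
  the support of `x` would lie in `s ∩ t`, i.e. `x ∈ conv t`), so the sets
  `|K| ∩ U_x ∩ B(x, ε)` form a basis of contractible neighbourhoods (`StarConvex.contractibleSpace`).
  This is the simplicial case of "CW complexes are locally contractible" (Hatcher, Prop. A.4).
* (T2) **A real algebraic model of `ℙ ℂ ℂⁿ`** (`ProjSemialg.projEmb`): the Hermitian (Veronese-type)
  coordinates `[z] ↦ (Re, Im of z_a \bar z_b / Σ_c |z_c|²)_{a,b} ∈ ℝ^{n² + n²}` — the matrix of
  the orthogonal projection onto the line `ℂ z` — form a continuous injection of the compact space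
  `ℙ ℂ ℂⁿ` (quotient topology, `Projectivization.compactSpace_of_properSpace`) into a Hausdorff
  space, hence a closed embedding (`ProjSemialg.isClosedEmbedding_projEmb`; injectivity: equal
  projections force `w = ⟨z, w⟩/⟨z, z⟩ · z`).
* (T3) **Projective algebraic sets have compact semialgebraic models**
  (`ProjSemialg.isSemialgebraic_image_projEmb`): for a finite set `S` of homogeneous polynomials
  the image of `V(S) ⊆ ℙ ℂ ℂⁿ` is the image of the `ℝ`-semialgebraic set
  `{x ∈ ℝ^{n+n} ∖ 0 | Re F(z(x)) = Im F(z(x)) = 0 ∀ F ∈ S}` (real and imaginary parts of a complex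
  polynomial are real polynomials, `ProjSemialg.exists_re_im_poly`) under a rational map with
  non-vanishing denominator, hence semialgebraic by the tree's PROVED Tarski–Seidenberg image
  theorem (`IsSemialgebraicMapOn.isSemialgebraic_image_holds`, BCR Prop. 2.2.7), and compact.
* (T4) **Complex points over a Zariski-closed subset are a projective algebraic set**
  (`EmbPoints.exists_homeomorph_projZeroLocus`): for a closed `k`-immersion `e : X ↪ ℙᴺ_ℂ` and a
  Zariski-closed `Z ⊆ X`, the closed set `e(Z)` is cut out by finitely many homogeneous
  polynomials `S` (Hilbert's basis theorem and the homogeneity of the vanishing ideal,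
  `EmbPoints.exists_finset_zeroLocus_eq`), and `P ↦ φ⁻¹(e(P))` (`φ = projPoint`, the tree's
  homeomorphism `ℙ ℂ ℂ^{N+1} ≅ ℙᴺ_ℂ(ℂ)`, Serre GAGA §2 n°5; complex points lift uniquely along
  closed immersions by the Nullstellensatz, as in `exists_hypersurfacePoint_eq`) restricts to a
  homeomorphism `{P ∈ X(ℂ) | pt P ∈ Z} ≃ₜ V(S)`.
* (T5) **(LC) from the triangulation fact** (`locallyContractibleSpace_complexPoints_of_c1Triangulation`):
  composing (T4), (T2)–(T3), the semialgebraic homeomorphism `|K| ≃ Φ(V(S))` of the named fact and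
  (T1), `Z(ℂ)` is homeomorphic to a finite polyhedron, hence locally contractible
  (`locallyContractibleSpace_of_homeomorph`). This is the classical "complex algebraic sets are
  triangulable, hence locally contractible" on the tree's carriers, with the triangulation theorem
  as the only input.

Results: `hodgeSectionRestriction_of_hodgeConjectureFor_of_pairing_of_c1Triangulation` — the
named fact from (P) and `OhmotoShiota2017_c1Triangulation`; and the SURFACE case entirely from
named facts already in the tree, `sectionRestriction_surface_of_hodgeIndex_of_c1Triangulation`:
for a smooth projective surface `X`, `hodgeIndex_surface X` + `lefschetzOneOne_rational` (which
give (P) for `n = 1`, `exists_cup_ne_zero_of_hodgeIndex`) + `OhmotoShiota2017_c1Triangulation`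
imply that every non-zero rational `(1,1)`-class restricts non-trivially to some curve section
(Kerr–Pearlstein 2011, Example 43; the landing pad `SectionRestrictionSurface`).

## What is NOT here

(P) for `n ≥ 2`: the non-degeneracy of the cup product on the rational `(n, n)`-classes of a
smooth projective `2n`-fold (hard Lefschetz `nonempty_hardLefschetzNFold` + Lefschetz
decomposition over `ℚ` + the Hodge–Riemann bilinear relations for the cup product transported
along the de Rham comparison of a Hodge model, with the complex orientation `H^{4n}(X(ℂ); ℂ) ≅ ℂ`);
the tree has no carrier for the Hodge–Riemann relations on the summit side, and none is vendored
here (D-0026). The triangulation theorem itself (the named fact) is not proved here either.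

## References

* [BrosnanFangNiePearlstein2009] P. Brosnan, H. Fang, Z. Nie, G. Pearlstein, Singularities of
  admissible normal functions, Invent. Math. 177 (2009) 599–629, §6 Lemma 49, Lemma 50
  (arXiv:0711.0964, p. 13).
* [OhmotoShiota2017] T. Ohmoto, M. Shiota, `C¹`-triangulations of semialgebraic sets, J. Topology
  10 (2017), Thm. 1.1 and Thm. 2.2 (Łojasiewicz's semialgebraic triangulation).
* [BochnakCosteRoy1998] J. Bochnak, M. Coste, M.-F. Roy, Real Algebraic Geometry (1998), Thm. 2.2.1,
  Prop. 2.2.7 (images of semialgebraic maps), Thm. 9.2.1 (triangulation).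
* [HatcherAT2002] A. Hatcher, Algebraic Topology (CUP 2002), Appendix, Prop. A.4 (CW complexes
  are locally contractible), Thm. A.7.
* [SerreGAGA1956] J.-P. Serre, Géométrie algébrique et géométrie analytique, Ann. Inst. Fourier 6
  (1956), §2 n°5.
* [KerrPearlstein2011] M. Kerr, G. Pearlstein, An exponential history of functions with
  logarithmic growth, MSRI Publ. 58 (2011), Example 43.
-/

noncomputable section

open Set Filter Topology
open CategoryTheory AlgebraicGeometry
open Literature.AlgebraicTopology.SingularHomology Literature.AlgebraicTopology.Homotopy
open Literature.ModelTheory.ExponentialFields Literature.NumberTheory.Transcendental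

namespace Literature.AlgebraicGeometry.HodgeTheory

/-! ## (T1) Polyhedra of finite simplicial complexes are locally contractible -/

namespace Polyhedron

variable {E : Type*} [NormedAddCommGroup E] [NormedSpace ℝ E]

/-- The open set `U_x = ⋂ {(conv t)ᶜ : t ∈ K, x ∉ conv t}` whose trace on `|K|` is the open star
of `x` (the complement of the simplices not containing `x`). [cite: HatcherAT2002, App. Prop. A.4] -/
def starNhd (K : Geometry.SimplicialComplex ℝ E) (x : E) : Set E :=
  {y | ∀ t ∈ K.faces, y ∈ convexHull ℝ (t : Set E) → x ∈ convexHull ℝ (t : Set E)}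

/-- `x ∈ U_x`. [folklore] -/
theorem mem_starNhd_self (K : Geometry.SimplicialComplex ℝ E) (x : E) : x ∈ starNhd K x :=
  fun _ _ h ↦ h

/-- `U_x` as the intersection of the complements of the simplices missing `x`. [folklore] -/
theorem starNhd_eq_biInter (K : Geometry.SimplicialComplex ℝ E) (x : E) :
    starNhd K x =
      ⋂ t ∈ {t ∈ K.faces | x ∉ convexHull ℝ (t : Set E)}, (convexHull ℝ (t : Set E))ᶜ := by
  ext y
  simp only [starNhd, mem_setOf_eq, mem_iInter, mem_compl_iff]
  constructor
  · intro h t ⟨ht, hxt⟩ hyt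
    exact hxt (h t ht hyt)
  · intro h t ht hyt
    by_contra hxt
    exact h t ⟨ht, hxt⟩ hyt

/-- For a finite complex, `U_x` is open (a finite intersection of complements of compact
simplices). [folklore] -/
theorem isOpen_starNhd {K : Geometry.SimplicialComplex ℝ E} (hK : K.faces.Finite) (x : E) :
    IsOpen (starNhd K x) := by
  rw [starNhd_eq_biInter]
  refine Set.Finite.isOpen_biInter (hK.subset (fun t ht ↦ ht.1)) fun t _ ↦ ?_
  exact (Set.Finite.isClosed_convexHull ℝ (s := (t : Set E)) t.finite_toSet).isOpen_compl

/-- **Barycentric support lemma.** In a simplex with affinely independent vertex set `s`: if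
`a • x + b • y` (`a > 0`, `b ≥ 0`, `a + b = 1`, `x, y ∈ conv s`) lies in the face spanned by
`u ⊆ s`, then so does `x` — the weights of `x` off `u` vanish, by uniqueness of barycentric
coordinates (`AffineIndependent.eq_of_sum_eq_sum_subtype`). [folklore] -/
theorem mem_convexHull_of_combo_mem {s u : Finset E} (hs : AffineIndependent ℝ ((↑) : s → E))
    (hus : u ⊆ s) {x y : E} (hx : x ∈ convexHull ℝ (s : Set E))
    (hy : y ∈ convexHull ℝ (s : Set E)) {a b : ℝ} (ha : 0 < a) (hb : 0 ≤ b) (hab : a + b = 1)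
    (hz : a • x + b • y ∈ convexHull ℝ (u : Set E)) : x ∈ convexHull ℝ (u : Set E) := by
  classical
  obtain ⟨w₁, hw₁0, hw₁1, hw₁x⟩ := Finset.mem_convexHull'.mp hx
  obtain ⟨w₂, hw₂0, hw₂1, hw₂y⟩ := Finset.mem_convexHull'.mp hy
  obtain ⟨w₃, hw₃0, hw₃1, hw₃z⟩ := Finset.mem_convexHull'.mp hz
  -- the two weight systems for `z` on `s`
  set W : E → ℝ := fun v ↦ a * w₁ v + b * w₂ v with hW
  set W' : E → ℝ := fun v ↦ if v ∈ u then w₃ v else 0 with hW'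
  have hsum : ∑ v ∈ s, W v = ∑ v ∈ s, W' v := by
    simp only [hW, hW', Finset.sum_add_distrib, ← Finset.mul_sum, hw₁1, hw₂1, mul_one,
      Finset.sum_ite_mem, Finset.inter_eq_right.mpr hus, hw₃1, hab]
  have hsumv : ∑ v ∈ s, W v • v = ∑ v ∈ s, W' v • v := by
    simp only [hW, hW', add_smul, mul_smul, Finset.sum_add_distrib, ← Finset.smul_sum, hw₁x, hw₂y,
      ite_smul, zero_smul, Finset.sum_ite_mem, Finset.inter_eq_right.mpr hus, hw₃z]
  have heq := hs.eq_of_sum_eq_sum_subtype hsum hsumv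
  -- off `u`, the weight of `x` vanishes
  have hoff : ∀ v ∈ s, v ∉ u → w₁ v = 0 := by
    intro v hv hvu
    have h := heq v hv
    simp only [hW, hW', hvu, if_false] at h
    have h1 : 0 ≤ a * w₁ v := mul_nonneg ha.le (hw₁0 v hv)
    have h2 : 0 ≤ b * w₂ v := mul_nonneg hb (hw₂0 v hv)
    have h3 : a * w₁ v = 0 := by linarith
    rcases mul_eq_zero.mp h3 with h4 | h4
    · exact absurd h4 ha.ne'
    · exact h4
  refine Finset.mem_convexHull'.mpr ⟨w₁, fun v hv ↦ hw₁0 v (hus hv), ?_, ?_⟩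
  · rw [← hw₁1]
    exact Finset.sum_subset hus fun v hv hvu ↦ hoff v hv hvu
  · rw [← hw₁x]
    exact Finset.sum_subset hus fun v hv hvu ↦ by rw [hoff v hv hvu, zero_smul]

/-- **Open stars are star-shaped**: `|K| ∩ U_x` is star-convex about `x`. If `y ∈ |K| ∩ U_x` lies
in the simplex `conv s`, then `x ∈ conv s`; a point `a • x + b • y` of the segment lies in `conv s`,
and if it lay in a simplex `conv t ∌ x` it would lie in `conv s ∩ conv t = conv (s ∩ t)`
(`Geometry.SimplicialComplex.convexHull_inter_convexHull`), forcing `x ∈ conv (s ∩ t) ⊆ conv t`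
by the support lemma (for `a > 0`; for `a = 0` the point is `y`). [cite: HatcherAT2002, App. Prop. A.4] -/
theorem starConvex_space_inter_starNhd (K : Geometry.SimplicialComplex ℝ E) (x : E) :
    StarConvex ℝ x (K.space ∩ starNhd K x) := by
  intro y hy a b ha hb hab
  obtain ⟨hyK, hyU⟩ := hy
  obtain ⟨s, hs, hys⟩ := Geometry.SimplicialComplex.mem_space_iff.mp hyK
  have hxs : x ∈ convexHull ℝ (s : Set E) := hyU s hs hys
  have hzs : a • x + b • y ∈ convexHull ℝ (s : Set E) :=
    (convex_convexHull ℝ _) hxs hys ha hb hab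
  refine ⟨Geometry.SimplicialComplex.convexHull_subset_space hs hzs, fun t ht hzt ↦ ?_⟩
  rcases ha.eq_or_lt with rfl | ha'
  · -- `a = 0`: the point is `y`
    rw [zero_add] at hab
    subst hab
    rw [zero_smul, zero_add, one_smul] at hzt
    exact hyU t ht hzt
  · -- `a > 0`: the carrier face of the point contains `x`
    classical
    have hzst : a • x + b • y ∈ convexHull ℝ ((s ∩ t : Finset E) : Set E) := by
      rw [Finset.coe_inter, ← Geometry.SimplicialComplex.convexHull_inter_convexHull hs ht]
      exact ⟨hzs, hzt⟩
    have hxst := mem_convexHull_of_combo_mem (K.indep hs) Finset.inter_subset_left hxs hys ha' hb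
      hab hzst
    exact convexHull_mono (by rw [Finset.coe_inter]; exact Set.inter_subset_right) hxst

/-- Basic neighbourhoods of `x` in the polyhedron: the trace of `U_x ∩ B(x, ε)` on `|K|`, as a
subset of the subtype `|K|`. [folklore] -/
def basicNhd (K : Geometry.SimplicialComplex ℝ E) (x : K.space) (ε : ℝ) : Set K.space :=
  Subtype.val ⁻¹' (starNhd K (x : E) ∩ Metric.ball (x : E) ε)

/-- Basic neighbourhoods are open. [folklore] -/
theorem isOpen_basicNhd {K : Geometry.SimplicialComplex ℝ E} (hK : K.faces.Finite) (x : K.space)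
    (ε : ℝ) : IsOpen (basicNhd K x ε) :=
  ((isOpen_starNhd hK _).inter Metric.isOpen_ball).preimage continuous_subtype_val

/-- `x` lies in its basic neighbourhoods. [folklore] -/
theorem mem_basicNhd_self {K : Geometry.SimplicialComplex ℝ E} (x : K.space) {ε : ℝ}
    (hε : 0 < ε) : x ∈ basicNhd K x ε :=
  ⟨mem_starNhd_self K _, Metric.mem_ball_self hε⟩

/-- A basic neighbourhood is homeomorphic to the star-shaped set `|K| ∩ U_x ∩ B(x, ε) ⊆ E`.
[folklore] -/
def basicNhdHomeomorph (K : Geometry.SimplicialComplex ℝ E) (x : K.space) (ε : ℝ) :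
    basicNhd K x ε ≃ₜ (K.space ∩ starNhd K (x : E) ∩ Metric.ball (x : E) ε : Set E) where
  toFun y := ⟨y.1.1, ⟨y.1.2, y.2.1⟩, y.2.2⟩
  invFun z := ⟨⟨z.1, z.2.1.1⟩, z.2.1.2, z.2.2⟩
  left_inv _ := rfl
  right_inv _ := rfl
  continuous_toFun := (continuous_subtype_val.comp continuous_subtype_val).subtype_mk _
  continuous_invFun := (continuous_subtype_val.subtype_mk _).subtype_mk _

/-- Basic neighbourhoods are contractible (star-shaped and non-empty).
[cite: HatcherAT2002, App. Prop. A.4] -/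
theorem contractibleSpace_basicNhd (K : Geometry.SimplicialComplex ℝ E) (x : K.space) {ε : ℝ}
    (hε : 0 < ε) : ContractibleSpace (basicNhd K x ε) := by
  have hstar : StarConvex ℝ (x : E) (K.space ∩ starNhd K (x : E) ∩ Metric.ball (x : E) ε) :=
    (starConvex_space_inter_starNhd K (x : E)).inter ((convex_ball (x : E) ε).starConvex
      (Metric.mem_ball_self hε))
  have hne : (K.space ∩ starNhd K (x : E) ∩ Metric.ball (x : E) ε).Nonempty :=
    ⟨x, ⟨x.2, mem_starNhd_self K _⟩, Metric.mem_ball_self hε⟩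
  haveI := hstar.contractibleSpace hne
  exact (basicNhdHomeomorph K x ε).contractibleSpace

/-- The basic neighbourhoods form a neighbourhood basis of `x` in `|K|`. [folklore] -/
theorem hasBasis_basicNhd {K : Geometry.SimplicialComplex ℝ E} (hK : K.faces.Finite)
    (x : K.space) : (𝓝 x).HasBasis (fun ε : ℝ ↦ 0 < ε) (basicNhd K x) := by
  refine ⟨fun U ↦ ⟨fun hU ↦ ?_, fun ⟨ε, hε, hU⟩ ↦ ?_⟩⟩
  · obtain ⟨ε, hε, hball⟩ := Metric.nhds_basis_ball.mem_iff.mp hU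
    exact ⟨ε, hε, fun y hy ↦ hball (by
      rw [Metric.mem_ball, Subtype.dist_eq]
      exact hy.2)⟩
  · exact Filter.mem_of_superset ((isOpen_basicNhd hK x ε).mem_nhds (mem_basicNhd_self x hε)) hU

/-- **The polyhedron of a finite simplicial complex is strongly locally contractible** (every point
has a basis of contractible neighbourhoods: the traces of the open star on small balls).
[cite: HatcherAT2002, App. Prop. A.4] -/
theorem stronglyLocallyContractibleSpace_space {K : Geometry.SimplicialComplex ℝ E}
    (hK : K.faces.Finite) : StronglyLocallyContractibleSpace K.space :=
  .of_bases (fun x ↦ hasBasis_basicNhd hK x) fun x _ hε ↦ contractibleSpace_basicNhd K x hε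

/-- **The polyhedron of a finite simplicial complex is locally contractible** (Mathlib's classical
`LocallyContractibleSpace`, implied by the strong form). [cite: HatcherAT2002, App. Prop. A.4] -/
theorem locallyContractibleSpace_space {K : Geometry.SimplicialComplex ℝ E}
    (hK : K.faces.Finite) : LocallyContractibleSpace K.space :=
  haveI := stronglyLocallyContractibleSpace_space hK
  StronglyLocallyContractibleSpace.locallyContractible

end Polyhedron

/-! ## (T2)–(T3) A compact semialgebraic model of a projective algebraic subset of `ℙ ℂ ℂⁿ` -/

namespace ProjSemialg

open MvPolynomial
open scoped ComplexConjugate LinearAlgebra.Projectivization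

variable {n : ℕ}

/-! ### Real coordinates on `ℂⁿ` -/

/-- Real and imaginary parts: `ℂⁿ → ℝ^{n+n}`, `z ↦ (Re z, Im z)`. [folklore] -/
def realify (z : Fin n → ℂ) : Fin (n + n) → ℝ :=
  Fin.append (fun i ↦ (z i).re) (fun i ↦ (z i).im)

/-- The inverse identification `ℝ^{n+n} → ℂⁿ`, `x ↦ (x_i + i x_{n+i})_i`. [folklore] -/
def complexify (x : Fin (n + n) → ℝ) : Fin n → ℂ :=
  fun i ↦ ⟨x (Fin.castAdd n i), x (Fin.natAdd n i)⟩

/-- First block of `realify`: real parts. [folklore] -/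
@[simp] theorem realify_castAdd (z : Fin n → ℂ) (i : Fin n) :
    realify z (Fin.castAdd n i) = (z i).re := by
  simp only [realify, Fin.append_left]

/-- Second block of `realify`: imaginary parts. [folklore] -/
@[simp] theorem realify_natAdd (z : Fin n → ℂ) (i : Fin n) :
    realify z (Fin.natAdd n i) = (z i).im := by
  simp only [realify, Fin.append_right]

/-- Real part of `complexify`. [folklore] -/
@[simp] theorem complexify_apply_re (x : Fin (n + n) → ℝ) (i : Fin n) :
    (complexify x i).re = x (Fin.castAdd n i) := rfl

/-- Imaginary part of `complexify`. [folklore] -/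
@[simp] theorem complexify_apply_im (x : Fin (n + n) → ℝ) (i : Fin n) :
    (complexify x i).im = x (Fin.natAdd n i) := rfl

/-- `complexify ∘ realify = id`. [folklore] -/
@[simp] theorem complexify_realify (z : Fin n → ℂ) : complexify (realify z) = z := by
  funext i
  apply Complex.ext
  · rw [complexify_apply_re, realify_castAdd]
  · rw [complexify_apply_im, realify_natAdd]

/-- `realify ∘ complexify = id`. [folklore] -/
@[simp] theorem realify_complexify (x : Fin (n + n) → ℝ) : realify (complexify x) = x := by
  funext j
  refine Fin.addCases (fun i ↦ ?_) (fun i ↦ ?_) j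
  · rw [realify_castAdd, complexify_apply_re]
  · rw [realify_natAdd, complexify_apply_im]

/-- `realify 0 = 0`. [folklore] -/
@[simp] theorem realify_zero : realify (0 : Fin n → ℂ) = 0 := by
  funext j
  refine Fin.addCases (fun i ↦ ?_) (fun i ↦ ?_) j
  · rw [realify_castAdd]; rfl
  · rw [realify_natAdd]; rfl

/-- `complexify 0 = 0`. [folklore] -/
@[simp] theorem complexify_zero : complexify (0 : Fin (n + n) → ℝ) = 0 := by
  funext i
  apply Complex.ext <;> rfl

/-- `complexify x = 0 ↔ x = 0`. [folklore] -/
theorem complexify_eq_zero_iff (x : Fin (n + n) → ℝ) : complexify x = 0 ↔ x = 0 := by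
  constructor
  · intro h
    rw [← realify_complexify x, h, realify_zero]
  · rintro rfl
    exact complexify_zero

/-- `complexify x i = x_i + i·x_{n+i}`. [folklore] -/
theorem complexify_apply_eq (x : Fin (n + n) → ℝ) (i : Fin n) :
    complexify x i = (x (Fin.castAdd n i) : ℂ) + (x (Fin.natAdd n i) : ℂ) * Complex.I := by
  apply Complex.ext
  · simp [complexify_apply_re]
  · simp [complexify_apply_im]

/-! ### Real and imaginary parts of a complex polynomial are real polynomials -/

/-- Every complex polynomial `F` in `n` variables has real polynomials `P, Q` in `n + n` variables
with `F(z(x)) = P(x) + i Q(x)` (induction on `F`). [folklore] -/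
theorem exists_re_im_poly (F : MvPolynomial (Fin n) ℂ) :
    ∃ P Q : MvPolynomial (Fin (n + n)) ℝ, ∀ x : Fin (n + n) → ℝ,
      eval (complexify x) F = (aeval x P : ℝ) + (aeval x Q : ℝ) * Complex.I := by
  induction F using MvPolynomial.induction_on with
  | C c =>
    refine ⟨C c.re, C c.im, fun x ↦ ?_⟩
    simp [Complex.re_add_im]
  | add p q hp hq =>
    obtain ⟨P₁, Q₁, h₁⟩ := hp
    obtain ⟨P₂, Q₂, h₂⟩ := hq
    refine ⟨P₁ + P₂, Q₁ + Q₂, fun x ↦ ?_⟩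
    rw [map_add, h₁ x, h₂ x]
    simp only [map_add]
    push_cast
    ring
  | mul_X p i hp =>
    obtain ⟨P, Q, h⟩ := hp
    refine ⟨P * X (Fin.castAdd n i) - Q * X (Fin.natAdd n i),
      P * X (Fin.natAdd n i) + Q * X (Fin.castAdd n i), fun x ↦ ?_⟩
    rw [map_mul, h x, eval_X, complexify_apply_eq]
    simp only [map_sub, map_mul, map_add, aeval_X]
    push_cast
    ring_nf
    rw [Complex.I_sq]
    ring

/-- The real zero set `{x | F(z(x)) = 0}` of a complex polynomial is `ℝ`-semialgebraic (indeed real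
algebraic: `Re F = Im F = 0`). [cite: BochnakCosteRoy1998, Def. 2.1.4] -/
theorem isSemialgebraic_setOf_eval_complexify_eq_zero (F : MvPolynomial (Fin n) ℂ) :
    IsSemialgebraic ℝ {x : Fin (n + n) → ℝ | eval (complexify x) F = 0} := by
  obtain ⟨P, Q, h⟩ := exists_re_im_poly F
  have hset : {x : Fin (n + n) → ℝ | eval (complexify x) F = 0} =
      {x | aeval x P = 0} ∩ {x | aeval x Q = 0} := by
    ext x
    simp only [mem_setOf_eq, mem_inter_iff, h x]
    constructor
    · intro h0
      have hre := congrArg Complex.re h0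
      have him := congrArg Complex.im h0
      simp at hre him
      exact ⟨hre, him⟩
    · rintro ⟨h1, h2⟩
      rw [h1, h2]
      simp
  rw [hset]
  exact (isSemialgebraic_setOf_eval_eq_zero P).inter (isSemialgebraic_setOf_eval_eq_zero Q)

/-! ### The Hermitian (Veronese-type) coordinates -/

/-- `q(z) = Σ_c |z_c|²`. [folklore] -/
def sqNorm (z : Fin n → ℂ) : ℝ := ∑ c, Complex.normSq (z c)

/-- `q(z) ≥ 0`. [folklore] -/
theorem sqNorm_nonneg (z : Fin n → ℂ) : 0 ≤ sqNorm z :=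
  Finset.sum_nonneg fun _ _ ↦ Complex.normSq_nonneg _

/-- `q(z) = 0 ↔ z = 0`. [folklore] -/
theorem sqNorm_eq_zero_iff (z : Fin n → ℂ) : sqNorm z = 0 ↔ z = 0 := by
  rw [sqNorm, Finset.sum_eq_zero_iff_of_nonneg fun c _ ↦ Complex.normSq_nonneg _]
  simp [funext_iff]

/-- `q(z) > 0` for `z ≠ 0`. [folklore] -/
theorem sqNorm_pos {z : Fin n → ℂ} (hz : z ≠ 0) : 0 < sqNorm z :=
  (sqNorm_nonneg z).lt_of_ne' (by rwa [Ne, sqNorm_eq_zero_iff])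

/-- `q(t z) = |t|² q(z)`. [folklore] -/
theorem sqNorm_smul (t : ℂ) (z : Fin n → ℂ) : sqNorm (t • z) = Complex.normSq t * sqNorm z := by
  simp [sqNorm, Finset.mul_sum]

/-- `q` is continuous. [folklore] -/
theorem continuous_sqNorm : Continuous (sqNorm : (Fin n → ℂ) → ℝ) :=
  continuous_finsetSum _ fun c _ ↦ Complex.continuous_normSq.comp (continuous_apply c)

/-- The entries `h_{ab}(z) = z_a \bar z_b / q(z)` of the orthogonal projection onto the line `ℂ z`.
[folklore] -/
def herm (z : Fin n → ℂ) (a b : Fin n) : ℂ := z a * conj (z b) / (sqNorm z : ℂ)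

/-- `h_{ab}` is invariant under `z ↦ t z`, `t ≠ 0`. [folklore] -/
theorem herm_smul {t : ℂ} (ht : t ≠ 0) {z : Fin n → ℂ} (hz : z ≠ 0) (a b : Fin n) :
    herm (t • z) a b = herm z a b := by
  have hq : (sqNorm z : ℂ) ≠ 0 := by exact_mod_cast (sqNorm_pos hz).ne'
  have htt : t * conj t = (Complex.normSq t : ℂ) := Complex.mul_conj t
  have hnt : (Complex.normSq t : ℂ) ≠ 0 := by exact_mod_cast (Complex.normSq_pos.mpr ht).ne'
  simp only [herm, Pi.smul_apply, smul_eq_mul, map_mul, sqNorm_smul, Complex.ofReal_mul]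
  rw [div_eq_div_iff (mul_ne_zero hnt hq) hq]
  rw [← htt]
  ring

/-- The Hermitian coordinates of a vector, as a point of `ℝ^{n² + n²}` (real parts, then imaginary
parts, pairs `(a, b)` enumerated by `finProdFinEquiv`). [folklore] -/
def hermCoord (z : Fin n → ℂ) : Fin (n * n + n * n) → ℝ :=
  Fin.append (fun k ↦ (herm z (finProdFinEquiv.symm k).1 (finProdFinEquiv.symm k).2).re)
    (fun k ↦ (herm z (finProdFinEquiv.symm k).1 (finProdFinEquiv.symm k).2).im)

/-- `hermCoord` is invariant under `z ↦ t z`, `t ≠ 0`. [folklore] -/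
theorem hermCoord_smul {t : ℂ} (ht : t ≠ 0) {z : Fin n → ℂ} (hz : z ≠ 0) :
    hermCoord (t • z) = hermCoord z := by
  ext j
  refine Fin.addCases (fun k ↦ ?_) (fun k ↦ ?_) j
  · simp [hermCoord, herm_smul ht hz]
  · simp [hermCoord, herm_smul ht hz]

/-- `herm` is recovered from `hermCoord`. [folklore] -/
theorem herm_eq_of_hermCoord_eq {z w : Fin n → ℂ} (h : hermCoord z = hermCoord w) (a b : Fin n) :
    herm z a b = herm w a b := by
  have h1 := congr_fun h (Fin.castAdd (n * n) (finProdFinEquiv (a, b)))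
  have h2 := congr_fun h (Fin.natAdd (n * n) (finProdFinEquiv (a, b)))
  simp only [hermCoord, Fin.append_left, Fin.append_right, Equiv.symm_apply_apply] at h1 h2
  exact Complex.ext h1 h2

/-- `hermCoord` is continuous off the origin. [folklore] -/
theorem continuousOn_hermCoord : ContinuousOn (hermCoord : (Fin n → ℂ) → _) {z | z ≠ 0} := by
  refine continuousOn_pi.mpr fun j ↦ ?_
  have hh : ∀ a b : Fin n, ContinuousOn (fun z : Fin n → ℂ ↦ herm z a b) {z | z ≠ 0} := by
    intro a b
    refine ContinuousOn.div ?_ ?_ fun z hz ↦ ?_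
    · exact ((continuous_apply a).mul
        (Complex.continuous_conj.comp (continuous_apply b))).continuousOn
    · exact (Complex.continuous_ofReal.comp continuous_sqNorm).continuousOn
    · exact_mod_cast (sqNorm_pos hz).ne'
  refine Fin.addCases (fun k ↦ ?_) (fun k ↦ ?_) j
  · simp only [hermCoord, Fin.append_left]
    exact Complex.continuous_re.comp_continuousOn (hh _ _)
  · simp only [hermCoord, Fin.append_right]
    exact Complex.continuous_im.comp_continuousOn (hh _ _)

/-- **Injectivity up to scalars**: equal Hermitian coordinates force proportional vectors
(`w = (⟨z, w⟩ / q(z)) · z`, summing `h_{ab}(z) w_b = h_{ab}(w) w_b` over `b`). [folklore] -/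
theorem exists_smul_eq_of_hermCoord_eq {z w : Fin n → ℂ} (hw : w ≠ 0)
    (h : hermCoord z = hermCoord w) : ∃ c : ℂ, c • z = w := by
  have hqw : (sqNorm w : ℂ) ≠ 0 := by exact_mod_cast (sqNorm_pos hw).ne'
  refine ⟨(∑ b, conj (z b) * w b) / (sqNorm z : ℂ), funext fun a ↦ ?_⟩
  have key : ∀ b, z a * conj (z b) / (sqNorm z : ℂ) = w a * conj (w b) / (sqNorm w : ℂ) :=
    fun b ↦ herm_eq_of_hermCoord_eq h a b
  have hsumw : (∑ b, conj (w b) * w b) = (sqNorm w : ℂ) := by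
    simp only [sqNorm, Complex.ofReal_sum]
    refine Finset.sum_congr rfl fun b _ ↦ ?_
    rw [mul_comm, Complex.mul_conj]
  calc (((∑ b, conj (z b) * w b) / (sqNorm z : ℂ)) • z) a
      = ∑ b, (z a * conj (z b) / (sqNorm z : ℂ)) * w b := by
        rw [Pi.smul_apply, smul_eq_mul, Finset.sum_div, Finset.sum_mul]
        refine Finset.sum_congr rfl fun b _ ↦ ?_
        ring
    _ = ∑ b, (w a * conj (w b) / (sqNorm w : ℂ)) * w b := by
        refine Finset.sum_congr rfl fun b _ ↦ ?_
        rw [key b]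
    _ = w a * ((∑ b, conj (w b) * w b) / (sqNorm w : ℂ)) := by
        rw [Finset.sum_div, Finset.mul_sum]
        refine Finset.sum_congr rfl fun b _ ↦ ?_
        ring
    _ = w a := by rw [hsumw, div_self hqw, mul_one]

/-! ### The embedding `Φ : ℙ ℂ ℂⁿ → ℝ^{n² + n²}` -/

/-- **The Hermitian-coordinate map on projective space** `Φ : ℙ ℂ ℂⁿ → ℝ^{n² + n²}`,
`[z] ↦ (Re, Im of z_a \bar z_b / Σ|z_c|²)` (well defined: invariant under `z ↦ t z`). [folklore] -/
def projEmb (n : ℕ) : ℙ ℂ (Fin n → ℂ) → Fin (n * n + n * n) → ℝ :=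
  Projectivization.lift (fun v ↦ hermCoord v.1) (by
    rintro ⟨a, ha⟩ ⟨b, hb⟩ t (h : a = t • b)
    have ht : t ≠ 0 := by
      rintro rfl
      exact ha (by rw [h, zero_smul])
    change hermCoord a = hermCoord b
    rw [h, hermCoord_smul ht hb])

/-- `Φ [v] = hermCoord v`. [folklore] -/
@[simp] theorem projEmb_mk (v : Fin n → ℂ) (hv : v ≠ 0) :
    projEmb n (Projectivization.mk ℂ v hv) = hermCoord v :=
  Projectivization.lift_mk _ _ v hv

/-- `Φ` is continuous (quotient topology). [folklore] -/
theorem continuous_projEmb : Continuous (projEmb n) := by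
  rw [Projectivization.isQuotientMap_mk.continuous_iff]
  have : (projEmb n ∘ fun v : {v : Fin n → ℂ // v ≠ 0} ↦ Projectivization.mk ℂ v.1 v.2) =
      fun v ↦ hermCoord v.1 := by
    funext v
    simp
  rw [this]
  exact continuousOn_hermCoord.comp_continuous continuous_subtype_val fun v ↦ v.2

/-- `Φ` is injective. [folklore] -/
theorem projEmb_injective : Function.Injective (projEmb n) := by
  intro p q hpq
  induction p using Projectivization.ind with | h v hv => ?_
  induction q using Projectivization.ind with | h w hw => ?_
  simp only [projEmb_mk] at hpq
  obtain ⟨c, hc⟩ := exists_smul_eq_of_hermCoord_eq hv hpq.symm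
  exact (Projectivization.mk_eq_mk_iff' ℂ v w hv hw).mpr ⟨c, hc⟩

/-- **`Φ` is a closed embedding** (continuous injection from the compact space `ℙ ℂ ℂⁿ` —
the tree's `Projectivization.compactSpace_of_properSpace` — to a Hausdorff space): a real
algebraic model of `ℙ ℂ ℂⁿ`. [folklore] -/
theorem isClosedEmbedding_projEmb : IsClosedEmbedding (projEmb n) :=
  haveI : CompactSpace (ℙ ℂ (Fin n → ℂ)) := Projectivization.compactSpace_of_properSpace
  continuous_projEmb.isClosedEmbedding projEmb_injective

/-! ### The image of a projective algebraic set is semialgebraic -/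

/-- The real model of the cone over `V(S)` minus the origin:
`{x ∈ ℝ^{n+n} ∖ 0 | F(z(x)) = 0 ∀ F ∈ S}`. [folklore] -/
def coneSet (S : Finset (MvPolynomial (Fin n) ℂ)) : Set (Fin (n + n) → ℝ) :=
  {x | x ≠ 0 ∧ ∀ F ∈ S, eval (complexify x) F = 0}

/-- `Σ xᵢ²` as a real polynomial. [folklore] -/
def sqNormPoly (n : ℕ) : MvPolynomial (Fin (n + n)) ℝ := ∑ i, X i ^ 2

/-- `(Σ Xᵢ²)(x) = q(z(x))`. [folklore] -/
theorem aeval_sqNormPoly (x : Fin (n + n) → ℝ) :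
    aeval x (sqNormPoly n) = sqNorm (complexify x) := by
  simp only [sqNormPoly, map_sum, map_pow, aeval_X, sqNorm, Complex.normSq_apply,
    complexify_apply_re, complexify_apply_im]
  rw [Fin.sum_univ_add]
  simp only [← Finset.sum_add_distrib]
  refine Finset.sum_congr rfl fun i _ ↦ ?_
  ring

/-- The cone model is `ℝ`-semialgebraic. [cite: BochnakCosteRoy1998, Def. 2.1.4] -/
theorem isSemialgebraic_coneSet (S : Finset (MvPolynomial (Fin n) ℂ)) :
    IsSemialgebraic ℝ (coneSet S) := by
  have h0 : {x : Fin (n + n) → ℝ | x ≠ 0} = {x | aeval x (sqNormPoly n) ≠ 0} := by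
    ext x
    simp only [mem_setOf_eq, aeval_sqNormPoly, Ne, sqNorm_eq_zero_iff, complexify_eq_zero_iff]
  have h1 : coneSet S = {x : Fin (n + n) → ℝ | x ≠ 0} ∩
      ⋂ F ∈ S, {x | eval (complexify x) F = 0} := by
    ext x
    simp [coneSet]
  rw [h1, h0]
  exact (isSemialgebraic_setOf_eval_ne_zero _).inter
    (IsSemialgebraic.biInter S _ fun F _ ↦ isSemialgebraic_setOf_eval_complexify_eq_zero F)

/-- Numerators of the Hermitian coordinates (real parts): `x_a x_b + y_a y_b`. [folklore] -/
def hermNumRe (n : ℕ) (a b : Fin n) : MvPolynomial (Fin (n + n)) ℝ :=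
  X (Fin.castAdd n a) * X (Fin.castAdd n b) + X (Fin.natAdd n a) * X (Fin.natAdd n b)

/-- Numerators of the Hermitian coordinates (imaginary parts): `y_a x_b - x_a y_b`. [folklore] -/
def hermNumIm (n : ℕ) (a b : Fin n) : MvPolynomial (Fin (n + n)) ℝ :=
  X (Fin.natAdd n a) * X (Fin.castAdd n b) - X (Fin.castAdd n a) * X (Fin.natAdd n b)

/-- `Re h_{ab}(z(x))` is the rational function `hermNumRe / Σ Xᵢ²`. [folklore] -/
theorem herm_complexify_re (x : Fin (n + n) → ℝ) (a b : Fin n) :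
    (herm (complexify x) a b).re = aeval x (hermNumRe n a b) / aeval x (sqNormPoly n) := by
  rw [herm, Complex.div_ofReal_re, aeval_sqNormPoly]
  congr 1
  simp [hermNumRe, Complex.mul_re]

/-- `Im h_{ab}(z(x))` is the rational function `hermNumIm / Σ Xᵢ²`. [folklore] -/
theorem herm_complexify_im (x : Fin (n + n) → ℝ) (a b : Fin n) :
    (herm (complexify x) a b).im = aeval x (hermNumIm n a b) / aeval x (sqNormPoly n) := by
  rw [herm, Complex.div_ofReal_im, aeval_sqNormPoly]
  congr 1
  simp [hermNumIm, Complex.mul_im]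
  ring

/-- The Hermitian coordinate map is `ℝ`-semialgebraic on the cone model (rational coordinates with
non-vanishing denominator). [cite: BochnakCosteRoy1998, §2.2] -/
theorem isSemialgebraicMapOn_hermCoord_complexify (S : Finset (MvPolynomial (Fin n) ℂ)) :
    IsSemialgebraicMapOn ℝ (coneSet S) (fun x ↦ hermCoord (complexify x)) := by
  have hs := isSemialgebraic_coneSet S
  have hq : ∀ x ∈ coneSet S, aeval x (sqNormPoly n) ≠ 0 := by
    intro x hx
    rw [aeval_sqNormPoly, Ne, sqNorm_eq_zero_iff, complexify_eq_zero_iff]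
    exact hx.1
  refine IsSemialgebraicMapOn.of_forall hs fun j ↦ ?_
  refine Fin.addCases (fun k ↦ ?_) (fun k ↦ ?_) j
  · refine (isSemialgebraicFunOn_aeval_div_aeval hs (hermNumRe n (finProdFinEquiv.symm k).1
      (finProdFinEquiv.symm k).2) (sqNormPoly n) hq).congr fun x _ ↦ ?_
    simp only [hermCoord, Fin.append_left]
    rw [herm_complexify_re]
  · refine (isSemialgebraicFunOn_aeval_div_aeval hs (hermNumIm n (finProdFinEquiv.symm k).1
      (finProdFinEquiv.symm k).2) (sqNormPoly n) hq).congr fun x _ ↦ ?_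
    simp only [hermCoord, Fin.append_right]
    rw [herm_complexify_im]

/-- For `S` homogeneous, `Φ(V(S))` is the image of the cone model under the Hermitian coordinate
map. [folklore] -/
theorem image_projEmb_projZeroLocus (S : Finset (MvPolynomial (Fin n) ℂ))
    (hS : ∀ F ∈ S, F.IsHomogeneous F.totalDegree) :
    projEmb n '' Projectivization.projZeroLocus (S : Set (MvPolynomial (Fin n) ℂ)) =
      (fun x ↦ hermCoord (complexify x)) '' coneSet S := by
  apply Subset.antisymm
  · rintro _ ⟨p, hp, rfl⟩
    refine ⟨realify p.rep, ⟨?_, fun F hF ↦ ?_⟩, ?_⟩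
    · rw [Ne, ← complexify_eq_zero_iff, complexify_realify]
      exact p.rep_nonzero
    · rw [complexify_realify]
      exact hp F hF
    · simp only [complexify_realify]
      have h := projEmb_mk p.rep p.rep_nonzero
      rw [Projectivization.mk_rep] at h
      exact h.symm
  · rintro _ ⟨x, hx, rfl⟩
    have hz : complexify x ≠ 0 := by rw [Ne, complexify_eq_zero_iff]; exact hx.1
    refine ⟨Projectivization.mk ℂ (complexify x) hz, ?_, by simp⟩
    exact (Projectivization.mem_projZeroLocus_mk_iff hS _ hz).mpr hx.2

/-- **Projective algebraic sets have compact semialgebraic models**: for a finite set `S` of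
homogeneous polynomials, `Φ(V(S)) ⊆ ℝ^{n² + n²}` is `ℝ`-semialgebraic (image of a semialgebraic
set under a semialgebraic map — the tree's proved Tarski–Seidenberg image theorem).
[cite: BochnakCosteRoy1998, Prop. 2.2.7] -/
theorem isSemialgebraic_image_projEmb (S : Finset (MvPolynomial (Fin n) ℂ))
    (hS : ∀ F ∈ S, F.IsHomogeneous F.totalDegree) :
    IsSemialgebraic ℝ
      (projEmb n '' Projectivization.projZeroLocus (S : Set (MvPolynomial (Fin n) ℂ))) := by
  rw [image_projEmb_projZeroLocus S hS]
  exact IsSemialgebraicMapOn.isSemialgebraic_image_holds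
    (isSemialgebraicMapOn_hermCoord_complexify S) Subset.rfl (isSemialgebraic_coneSet S)

/-- `Φ(V(S))` is compact. [folklore] -/
theorem isCompact_image_projEmb (S : Finset (MvPolynomial (Fin n) ℂ))
    (hS : ∀ F ∈ S, F.IsHomogeneous F.totalDegree) :
    IsCompact (projEmb n '' Projectivization.projZeroLocus (S : Set (MvPolynomial (Fin n) ℂ))) :=
  haveI : CompactSpace (ℙ ℂ (Fin n → ℂ)) := Projectivization.compactSpace_of_properSpace
  ((Projectivization.isClosed_projZeroLocus hS).isCompact).image continuous_projEmb

/-- `V(S)` is homeomorphic to its semialgebraic model `Φ(V(S))`. [folklore] -/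
def projZeroLocusHomeomorph (S : Finset (MvPolynomial (Fin n) ℂ)) :
    Projectivization.projZeroLocus (S : Set (MvPolynomial (Fin n) ℂ)) ≃ₜ
      projEmb n '' Projectivization.projZeroLocus (S : Set (MvPolynomial (Fin n) ℂ)) :=
  ((isClosedEmbedding_projEmb.isEmbedding.comp IsEmbedding.subtypeVal).toHomeomorph).trans
    (Homeomorph.setCongr (by rw [Set.range_comp, Subtype.range_coe]))

end ProjSemialg

/-! ## (T4) Complex points over a Zariski-closed subset of an embedded projective scheme -/

namespace EmbPoints

open scoped LinearAlgebra.Projectivization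

attribute [local instance] MvPolynomial.gradedAlgebra

variable {N : ℕ}

/-- The grading of `ℂ[X₀, …, X_N]` by degree (local notation). [folklore] -/
local notation "𝓐" => MvPolynomial.homogeneousSubmodule (Fin (N + 1)) ℂ

/-- A homogeneous element of the graded polynomial ring is homogeneous of its total degree.
[folklore] -/
theorem isHomogeneous_totalDegree_of_mem {F : MvPolynomial (Fin (N + 1)) ℂ} {i : ℕ}
    (hF : F ∈ (𝓐) i) : F.IsHomogeneous F.totalDegree := by
  rw [MvPolynomial.mem_homogeneousSubmodule] at hF
  by_cases h0 : F = 0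
  · subst h0
    exact MvPolynomial.isHomogeneous_zero _ _ _
  · rwa [hF.totalDegree h0]

/-- **Every Zariski-closed subset of `ℙᴺ_ℂ` is cut out by finitely many homogeneous polynomials**:
`C = V₊(I(C))`, the homogeneous ideal `I(C)` is spanned by its homogeneous elements, and a finite
subfamily of them already spans (Hilbert's basis theorem). [cite: Hartshorne1977, II §2 and I Ex. 2.3] -/
theorem exists_finset_zeroLocus_eq (C : Set (ProjectiveSpectrum 𝓐)) (hC : IsClosed C) :
    ∃ S : Finset (MvPolynomial (Fin (N + 1)) ℂ), (∀ F ∈ S, F.IsHomogeneous F.totalDegree) ∧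
      ProjectiveSpectrum.zeroLocus 𝓐 (S : Set (MvPolynomial (Fin (N + 1)) ℂ)) = C := by
  classical
  set J := ProjectiveSpectrum.vanishingIdeal C with hJ
  obtain ⟨T, hT⟩ := (Ideal.IsHomogeneous.iff_exists 𝓐 J.toIdeal).mp J.isHomogeneous
  have hfg : (Ideal.span
      (((↑) : SetLike.homogeneousSubmonoid 𝓐 → MvPolynomial (Fin (N + 1)) ℂ) '' T)).FG := by
    rw [← hT]
    exact IsNoetherian.noetherian _
  obtain ⟨S, hST, hspan⟩ := (Submodule.fg_span_iff_fg_span_finset_subset _).mp hfg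
  refine ⟨S, fun F hF ↦ ?_, ?_⟩
  · obtain ⟨t, -, rfl⟩ := hST hF
    obtain ⟨i, hi⟩ := t.2
    exact isHomogeneous_totalDegree_of_mem hi
  · have hJS : J.toIdeal = Ideal.span (S : Set (MvPolynomial (Fin (N + 1)) ℂ)) := hT.trans hspan
    rw [← ProjectiveSpectrum.zeroLocus_span, ← hJS]
    change ProjectiveSpectrum.zeroLocus 𝓐 (J : Set (MvPolynomial (Fin (N + 1)) ℂ)) = C
    rw [hJ, ProjectiveSpectrum.zeroLocus_vanishingIdeal_eq_closure, hC.closure_eq]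

/-- For `F` homogeneous, `F` lies in the homogeneous prime of the point of `ℙᴺ_ℂ` under `φ([v])`
iff `F(v) = 0` (the tree's `preimage_projPoint_setOf_pt_mem_basicOpen`: `φ⁻¹(D₊(F)) = V(F)ᶜ`).
[cite: SerreGAGA1956, §2 n°5] -/
theorem mem_asHomogeneousIdeal_pt_projPoint_iff {F : MvPolynomial (Fin (N + 1)) ℂ}
    (hF : F.IsHomogeneous F.totalDegree) (p : ℙ ℂ (Fin (N + 1) → ℂ)) :
    F ∈ ((projPoint N p).pt : ProjectiveSpectrum 𝓐).asHomogeneousIdeal ↔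
      MvPolynomial.eval p.rep F = 0 := by
  have h1 : (projPoint N p).pt ∈ Proj.basicOpen 𝓐 F ↔
      p ∉ Projectivization.projZeroLocus ({F} : Set (MvPolynomial (Fin (N + 1)) ℂ)) := by
    have := Set.ext_iff.mp (preimage_projPoint_setOf_pt_mem_basicOpen N F _ hF) p
    simpa only [Set.mem_preimage, Set.mem_setOf_eq, Set.mem_compl_iff] using this
  have h2 : p ∈ Projectivization.projZeroLocus ({F} : Set (MvPolynomial (Fin (N + 1)) ℂ)) ↔
      MvPolynomial.eval p.rep F = 0 := by
    simp [Projectivization.projZeroLocus]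
  have h1' := (Proj.mem_basicOpen 𝓐 F _).symm.trans h1
  exact (not_iff_not.mp h1').trans h2

/-- `[v] ∈ V(S)` iff the point of `ℙᴺ_ℂ` under `φ([v])` lies in the Zariski-closed `V₊(S)`.
[cite: SerreGAGA1956, §2 n°5] -/
theorem pt_projPoint_mem_zeroLocus_iff {S : Finset (MvPolynomial (Fin (N + 1)) ℂ)}
    (hS : ∀ F ∈ S, F.IsHomogeneous F.totalDegree) (p : ℙ ℂ (Fin (N + 1) → ℂ)) :
    ((projPoint N p).pt : ProjectiveSpectrum 𝓐) ∈
        ProjectiveSpectrum.zeroLocus 𝓐 (S : Set (MvPolynomial (Fin (N + 1)) ℂ)) ↔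
      p ∈ Projectivization.projZeroLocus (S : Set (MvPolynomial (Fin (N + 1)) ℂ)) := by
  change ((S : Set (MvPolynomial (Fin (N + 1)) ℂ)) ⊆
      ((projPoint N p).pt : ProjectiveSpectrum 𝓐).asHomogeneousIdeal) ↔
    ∀ F ∈ (S : Set (MvPolynomial (Fin (N + 1)) ℂ)), MvPolynomial.eval p.rep F = 0
  exact ⟨fun h F hF ↦ (mem_asHomogeneousIdeal_pt_projPoint_iff (hS F hF) p).mp (h hF),
    fun h F hF ↦ (mem_asHomogeneousIdeal_pt_projPoint_iff (hS F hF) p).mpr (h F hF)⟩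

variable {X : Motives.SchemeOver ℂ}

/-- **Homogeneous coordinates of the complex points of an embedded projective scheme**:
`X(ℂ) → ℙ ℂ ℂ^{N+1}`, `P ↦ φ⁻¹(e(P))` (`φ = projPoint`, the homeomorphism
`ℙ ℂ ℂ^{N+1} ≅ ℙᴺ_ℂ(ℂ)`); the general-`X` form of `hypersurfacePoint`. [cite: SerreGAGA1956, §2 n°5] -/
def embPoint (e : Motives.ProjectiveEmbedding X) :
    Motives.ComplexPoints X → ℙ ℂ (Fin (e.n + 1) → ℂ) := fun P ↦
  ((isHomeomorph_projPoint e.n).homeomorph (projPoint e.n)).symm (Motives.AlgPoints.map e.ι P)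

/-- Defining property: `φ (embPoint e P) = e(P)`. [folklore] -/
@[simp]
theorem projPoint_embPoint (e : Motives.ProjectiveEmbedding X) (P : Motives.ComplexPoints X) :
    projPoint e.n (embPoint e P) = Motives.AlgPoints.map e.ι P :=
  ((isHomeomorph_projPoint e.n).homeomorph (projPoint e.n)).apply_symm_apply _

/-- `embPoint e` is a topological embedding (closed immersions embed complex points,
`Motives.AlgPoints.isEmbedding_map_of_isClosedImmersion`). [cite: SerreGAGA1956, §2 n°5 Lemme 1 b)] -/
theorem isEmbedding_embPoint (e : Motives.ProjectiveEmbedding X) : IsEmbedding (embPoint e) :=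
  (Homeomorph.isEmbedding _).comp (Motives.AlgPoints.isEmbedding_map_of_isClosedImmersion e.ι)

/-- **Complex points over a Zariski-closed subset form a projective algebraic set**: for a closed
`Z ⊆ X` there is a finite set `S` of homogeneous polynomials such that `P ↦ φ⁻¹(e(P))` restricts
to a homeomorphism `{P ∈ X(ℂ) | pt P ∈ Z} ≃ₜ V(S) ⊆ ℙ ℂ ℂ^{N+1}` (equations of `e(Z)` from
`exists_finset_zeroLocus_eq`; surjectivity: a point of `V₊(S) = e(Z)` under a complex point of
`ℙᴺ` is closed, and closed points of the finite-type `X` are complex points — Nullstellensatz,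
`Motives.ComplexPoints.equivClosedPoints`, as in `exists_hypersurfacePoint_eq`).
[cite: SerreGAGA1956, §2 n°5] -/
theorem exists_homeomorph_projZeroLocus (e : Motives.ProjectiveEmbedding X) {Z : Set X.left}
    (hZ : IsClosed Z) :
    ∃ S : Finset (MvPolynomial (Fin (e.n + 1)) ℂ), (∀ F ∈ S, F.IsHomogeneous F.totalDegree) ∧
      Nonempty ({P : Motives.ComplexPoints X // P.pt ∈ Z} ≃ₜ
        Projectivization.projZeroLocus (S : Set (MvPolynomial (Fin (e.n + 1)) ℂ))) := by
  haveI : LocallyOfFiniteType X.hom := by rw [← Over.w e.ι]; infer_instance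
  -- equations of the closed set `e(Z) ⊆ ℙᴺ`
  have hC : IsClosed (e.ι.left.base '' Z) := e.ι.left.isClosedEmbedding.isClosedMap _ hZ
  obtain ⟨S, hS, hSC⟩ := exists_finset_zeroLocus_eq (N := e.n) (e.ι.left.base '' Z) hC
  refine ⟨S, hS, ?_⟩
  -- membership in `V(S)` of the homogeneous coordinates of a complex point of `X`
  have hmem : ∀ P : Motives.ComplexPoints X,
      embPoint e P ∈ Projectivization.projZeroLocus (S : Set (MvPolynomial (Fin (e.n + 1)) ℂ)) ↔
        P.pt ∈ Z := by
    intro P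
    have h := pt_projPoint_mem_zeroLocus_iff hS (embPoint e P)
    rw [projPoint_embPoint, hSC] at h
    rw [← h]
    exact e.ι.left.isClosedEmbedding.injective.mem_set_image
  -- the restriction of `embPoint e` to `Z(ℂ)` is an embedding with image `V(S)`
  let f : {P : Motives.ComplexPoints X // P.pt ∈ Z} → ℙ ℂ (Fin (e.n + 1) → ℂ) :=
    fun P ↦ embPoint e P.1
  have hf : IsEmbedding f := (isEmbedding_embPoint e).comp IsEmbedding.subtypeVal
  have hrange : Set.range f =
      Projectivization.projZeroLocus (S : Set (MvPolynomial (Fin (e.n + 1)) ℂ)) := by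
    apply Set.Subset.antisymm
    · rintro _ ⟨P, rfl⟩
      exact (hmem P.1).mpr P.2
    · intro p hp
      -- the point of `ℙᴺ` under `p` lies in `e(Z)`; lift it to a complex point of `X`
      have hQS := (pt_projPoint_mem_zeroLocus_iff hS p).mpr hp
      rw [hSC] at hQS
      obtain ⟨y, hyZ, hy⟩ := hQS
      have hyc : IsClosed ({y} : Set X.left) := by
        have : ({y} : Set X.left) = e.ι.left.base ⁻¹' {(projPoint e.n p).pt} := by
          ext y'
          simp only [mem_singleton_iff, mem_preimage]
          exact ⟨by rintro rfl; exact hy,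
            fun h ↦ e.ι.left.isClosedEmbedding.injective (h.trans hy.symm)⟩
        rw [this]
        exact (projPoint e.n p).isClosed_pt.preimage e.ι.left.continuous
      set P := (Motives.ComplexPoints.equivClosedPoints X).symm ⟨y, hyc⟩ with hP
      have hpt : P.pt = y := by
        have := Motives.ComplexPoints.coe_equivClosedPoints_apply X P
        rw [hP, Equiv.apply_symm_apply] at this
        exact this.symm
      have hmap : Motives.AlgPoints.map e.ι P = projPoint e.n p := by
        refine Motives.ComplexPoints.ext_of_pt_eq ?_
        rw [Motives.AlgPoints.pt_map, hpt]
        exact hy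
      refine ⟨⟨P, hpt ▸ hyZ⟩, ?_⟩
      change embPoint e P = p
      apply projPoint_injective e.n
      rw [projPoint_embPoint, hmap]
  exact ⟨hf.toHomeomorph.trans (Homeomorph.setCongr hrange)⟩

end EmbPoints

/-! ## (T5) Local contractibility of `Z(ℂ)` from the semialgebraic triangulation theorem -/

section HodgeTheory

variable {X : Motives.SchemeOver ℂ}

/-- **(LC) from semialgebraic triangulation.** Granted the triangulation theorem for compact
semialgebraic sets (`OhmotoShiota2017_c1Triangulation`: a finite simplicial complex `K` and a
semialgebraic homeomorphism `|K| → T` for every compact semialgebraic `T`), the complex points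
`Z(ℂ) = {P ∈ X(ℂ) | pt P ∈ Z}` of every Zariski-closed subset `Z` of a `ℂ`-scheme `X` with a
projective embedding form a locally contractible space: `Z(ℂ) ≃ₜ V(S) ≃ₜ Φ(V(S)) ≃ₜ |K|`
(`EmbPoints.exists_homeomorph_projZeroLocus`, `ProjSemialg.projZeroLocusHomeomorph`, the fact
applied to the compact semialgebraic `Φ(V(S))`), and `|K|` is locally contractible
(`Polyhedron.locallyContractibleSpace_space`). Classical statement: complex algebraic sets are
triangulable (Łojasiewicz 1964), hence locally contractible.
[cite: OhmotoShiota2017, Thm. 1.1 with Thm. 2.2] [cite: HatcherAT2002, App. Prop. A.4] -/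
theorem locallyContractibleSpace_complexPoints_of_c1Triangulation
    (hOS : OhmotoShiota2017_c1Triangulation) (e : Motives.ProjectiveEmbedding X)
    {Z : Set X.left} (hZ : IsClosed Z) :
    LocallyContractibleSpace {P : Motives.ComplexPoints X // P.pt ∈ Z} := by
  obtain ⟨S, hS, ⟨φ₁⟩⟩ := EmbPoints.exists_homeomorph_projZeroLocus e hZ
  obtain ⟨m, K, f, g, hK, hfg, -⟩ := hOS.absolute (ProjSemialg.isSemialgebraic_image_projEmb S hS)
    (ProjSemialg.isCompact_image_projEmb S hS)
  exact locallyContractibleSpace_of_homeomorph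
    (φ₁.trans ((ProjSemialg.projZeroLocusHomeomorph S).trans hfg.toHomeomorph.symm)).symm
    (Polyhedron.locallyContractibleSpace_space hK)

/-- (LC) in the shape consumed by `HodgeSectionRestrictionProofs`: for every smooth projective
complex variety and every Zariski-closed `Z`, `Z(ℂ)` is locally contractible — granted the
semialgebraic triangulation theorem. [cite: OhmotoShiota2017, Thm. 1.1 with Thm. 2.2] -/
theorem locallyContractibleSpace_complexPoints_of_isSmoothProjective_of_c1Triangulation
    (hOS : OhmotoShiota2017_c1Triangulation) :
    ∀ ⦃n : ℕ⦄ ⦃X : Motives.SchemeOver ℂ⦄, Motives.IsSmoothProjective n X →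
      ∀ Z : Set X.left, IsClosed Z →
        LocallyContractibleSpace {P : Motives.ComplexPoints X // P.pt ∈ Z} :=
  fun _ _ hX _ hZ ↦
    locallyContractibleSpace_complexPoints_of_c1Triangulation hOS hX.isProjectiveOver.projectiveEmbedding hZ

/-- **Tautness of `Z(ℂ)` in `X(ℂ)` from the triangulation theorem**: for `X` smooth projective and
`Z ⊆ X` Zariski-closed, a class `c ∈ Hᵏ(X(ℂ); ℂ)` vanishing on `Z(ℂ)` vanishes on some open
neighbourhood of `Z(ℂ)` (`exists_isOpen_map_eq_zero_of_locallyContractibleSpace` with (LC) supplied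
by `locallyContractibleSpace_complexPoints_of_c1Triangulation`).
[cite: Spanier1981, Ch. 6 §1, Thm. 10 and Cor. 11] [cite: OhmotoShiota2017, Thm. 1.1] -/
theorem exists_isOpen_map_eq_zero_of_c1Triangulation (hOS : OhmotoShiota2017_c1Triangulation)
    {m : ℕ} (hX : Motives.IsSmoothProjective m X) {Z : Set X.left} (hZ : IsClosed Z) {k : ℕ}
    (c : complexBetti X k)
    (hc : singularCohomology.map ℂ ℂ
      (⟨Subtype.val, continuous_subtype_val⟩ :
        C({P : Motives.ComplexPoints X // P.pt ∈ Z}, Motives.ComplexPoints X)) k c = 0) :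
    ∃ V : Set (Motives.ComplexPoints X), IsOpen V ∧
      (∀ P : Motives.ComplexPoints X, P.pt ∈ Z → P ∈ V) ∧
      singularCohomology.map ℂ ℂ (subsetIncl V) k c = 0 :=
  exists_isOpen_map_eq_zero_of_locallyContractibleSpace hX hZ
    (locallyContractibleSpace_complexPoints_of_c1Triangulation hOS
      hX.isProjectiveOver.projectiveEmbedding hZ) c hc

/-! ### The named fact from (P) and the triangulation theorem -/

/-- **The named fact from (P) and the semialgebraic triangulation theorem.** Granted (P) the
non-degeneracy of the cup-product pairing on rational `(n, n)`-classes of every smooth projective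
complex `2n`-fold, `n ≥ 1` ("Poincaré duality and the Hodge–Riemann bilinear relations", BFNP §6,
the perfect pairing `Hdg^n X ⊗ Hdg^n X → ℚ` — the one input still absent from the tree), and the
tree's named fact `OhmotoShiota2017_c1Triangulation` (triangulation of compact semialgebraic sets,
which yields (LC) by `locallyContractibleSpace_complexPoints_of_c1Triangulation`), the printed proof
of Lemma 50 (`hodgeSectionRestriction_of_hodgeConjectureFor_of_pairing_of_locallyContractible`)
yields `hodgeSectionRestriction_of_hodgeConjectureFor`.
[cite: BrosnanFangNiePearlstein2009, §6 Lemma 50] [cite: OhmotoShiota2017, Thm. 1.1] -/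
theorem hodgeSectionRestriction_of_hodgeConjectureFor_of_pairing_of_c1Triangulation
    (hPair : ∀ ⦃n : ℕ⦄ ⦃X : Motives.SchemeOver ℂ⦄, 0 < n → Motives.IsSmoothProjective (2 * n) X →
      ∀ c : complexBetti X (2 * n), IsRationalClass c → IsOfHodgeType (2 * n) X (2 * n) n n c →
        c ≠ 0 → ∃ a : complexBetti X (2 * n), IsRationalClass a ∧
          IsOfHodgeType (2 * n) X (2 * n) n n a ∧
          cupProduct (rfl : 2 * n + 2 * n = 2 * n + 2 * n) c a ≠ 0)
    (hOS : OhmotoShiota2017_c1Triangulation) :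
    hodgeSectionRestriction_of_hodgeConjectureFor :=
  hodgeSectionRestriction_of_hodgeConjectureFor_of_pairing_of_locallyContractible hPair
    (locallyContractibleSpace_complexPoints_of_isSmoothProjective_of_c1Triangulation hOS)

/-! ### The surface case from the tree's named facts -/

/-- **The surface case from named facts of the tree** (Kerr–Pearlstein 2011, Example 43: on a
surface, a non-zero rational `(1,1)`-class restricts non-trivially to some curve section). For
`X` a smooth projective surface, granted the Hodge index theorem for `X` (`hodgeIndex_surface X`)
and Lefschetz `(1,1)` (`lefschetzOneOne_rational`) — which give a DIVISOR class `d` with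
`c ∪ d ≠ 0` (`exists_cup_ne_zero_of_hodgeIndex`: (P) and (H) for `n = 1` at once, without the
Hodge conjecture as a hypothesis) — and the semialgebraic triangulation theorem
(`OhmotoShiota2017_c1Triangulation`, giving (LC)), every non-zero rational `(1,1)`-class
`c ∈ H²(X(ℂ); ℂ)` restricts non-trivially to some curve section `e⁻¹ V₊(F) ≠ X`, `deg F ≥ 1`: the
statement of the landing pad
`Summit.HodgeConjecture.HodgeConjecture.Theses.HeightMassDefect.SectionRestrictionSurface` for `X`,
from three named facts of the tree and nothing else.
[cite: KerrPearlstein2011, Example 43] [cite: BrosnanFangNiePearlstein2009, §6 Lemma 50] -/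
theorem sectionRestriction_surface_of_hodgeIndex_of_c1Triangulation (hHI : hodgeIndex_surface X)
    (hL : lefschetzOneOne_rational) (hOS : OhmotoShiota2017_c1Triangulation)
    (hX : Motives.IsSmoothProjective 2 X) (e : Motives.ProjectiveEmbedding X)
    (c : complexBetti X 2) (hc : IsRationalClass c) (h11 : IsOfHodgeType 2 X 2 1 1 c)
    (hne : c ≠ 0) :
    ∃ (k : ℕ) (F : MvPolynomial (Fin (e.n + 1)) ℂ) (Z : Set X.left), 0 < k ∧ F.IsHomogeneous k ∧
      Z = e.ι.left.base ⁻¹' (letI := MvPolynomial.gradedAlgebra (σ := Fin (e.n + 1)) (R := ℂ);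
        ProjectiveSpectrum.zeroLocus (MvPolynomial.homogeneousSubmodule (Fin (e.n + 1)) ℂ) {F}) ∧
      Z ≠ Set.univ ∧
      singularCohomology.map ℂ ℂ
        (⟨Subtype.val, continuous_subtype_val⟩ :
          C({P : Motives.ComplexPoints X // P.pt ∈ Z}, Motives.ComplexPoints X)) 2 c ≠ 0 := by
  obtain ⟨d, -, -, hdN, hcd⟩ := exists_cup_ne_zero_of_hodgeIndex hHI hL hX c hc h11 hne
  exact exists_sectionRestriction_ne_zero_of_cup_ne_zero_of_locallyContractible (n := 1) one_pos hX
    (fun _ hZ ↦ locallyContractibleSpace_complexPoints_of_c1Triangulation hOS e hZ) e hdN hcd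

/-- **The surface case with the Hodge conjecture in place of the index theorem**: for a smooth
projective surface `X` satisfying `HodgeConjectureFor 2 X` (in the tree a consequence of Lefschetz
`(1,1)`, `hodgeConjectureFor_of_dim_le_three`), granted (P) for `X` in degree `2` and the
triangulation theorem, every non-zero rational `(1,1)`-class restricts non-trivially to some curve
section (`exists_sectionRestriction_ne_zero_of_pairing_of_locallyContractible` at `n = 1`).
[cite: BrosnanFangNiePearlstein2009, §6 Lemma 50] [cite: KerrPearlstein2011, Example 43] -/
theorem sectionRestriction_surface_of_pairing_of_c1Triangulation
    (hX : Motives.IsSmoothProjective 2 X) (hHC : HodgeConjectureFor 2 X)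
    (hPair : ∀ c : complexBetti X 2, IsRationalClass c → IsOfHodgeType 2 X 2 1 1 c → c ≠ 0 →
      ∃ a : complexBetti X 2, IsRationalClass a ∧ IsOfHodgeType 2 X 2 1 1 a ∧
        cupProduct two_add_two c a ≠ 0)
    (hOS : OhmotoShiota2017_c1Triangulation) (e : Motives.ProjectiveEmbedding X)
    (c : complexBetti X 2) (hc : IsRationalClass c) (h11 : IsOfHodgeType 2 X 2 1 1 c)
    (hne : c ≠ 0) :
    ∃ (k : ℕ) (F : MvPolynomial (Fin (e.n + 1)) ℂ) (Z : Set X.left), 0 < k ∧ F.IsHomogeneous k ∧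
      Z = e.ι.left.base ⁻¹' (letI := MvPolynomial.gradedAlgebra (σ := Fin (e.n + 1)) (R := ℂ);
        ProjectiveSpectrum.zeroLocus (MvPolynomial.homogeneousSubmodule (Fin (e.n + 1)) ℂ) {F}) ∧
      Z ≠ Set.univ ∧
      singularCohomology.map ℂ ℂ
        (⟨Subtype.val, continuous_subtype_val⟩ :
          C({P : Motives.ComplexPoints X // P.pt ∈ Z}, Motives.ComplexPoints X)) 2 c ≠ 0 :=
  exists_sectionRestriction_ne_zero_of_pairing_of_locallyContractible (n := 1) one_pos hX hHC hPair
    (fun _ hZ ↦ locallyContractibleSpace_complexPoints_of_c1Triangulation hOS e hZ) e c hc h11 hne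

end HodgeTheory

end Literature.AlgebraicGeometry.HodgeTheory

end
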